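import Summits.CriticalPhenomena.PercolationContinuityZ3.Theorems.SahiMasterFamilyDenseEndTraces
import Summits.CriticalPhenomena.PercolationContinuityZ3.Theorems.SahiMasterFamilyDenseEndFactor

/-!
# The dense end of Sahi's hierarchy, IV: at a cheapest double failure at most ONE pair of events splits

Support file of the master-family programme (crux `NoHeavyLowerTail`, stmt-CriticalPhenomena-4575; cell `prim-masterthm`, seat P4,
unit `prim-masterthm-p4-g5`).  Seat document HOME/prim-masterthm-p4/CORNERS.md §1, step (c3) of Theorem D.

Let `A : Fin k → Finset (Finset ι)` be increasing events (`∅ ∉ A_i`) and `c` a configuration lying in at least two of them and of the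
minimum such size `m₂` (`c ∈ doubly A`, `|c| = m2 A`).  The TRACES `tr_i = {a ⊆ c : a ∈ A_i}` of the events containing `c` then meet
pairwise only in `c` (`trace_pairwise`), so the lemmas of `SahiMasterFamilyDenseEndTraces` apply to every sub-family of `T(c) = {i : c ∈ A_i}`:

* `traceFam A S c` — the trace family of the sub-family indexed by `S ⊆ T(c)` (arity `|S|`), with its hypotheses
  (`traceFam_sub`, `traceFam_up`, `traceFam_empty_not_mem`, `traceFam_top_mem`, `traceFam_pairwise`);
* `split_forces_top` — if the pair `{i, j}` SPLITS `c` (`a ∈ tr_i`, `b ∈ tr_j`, `a ⊔ b = c`) then every other trace is `{c}`;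
* **`pair_eq_of_ncSystems_nonempty`** — hence at most one pair `S ⊆ T(c)` has a non-constant admissible system, and
  **`sum_card_ncSystems_le_one`**: `N(c) := Σ_{pairs S ⊆ T(c)} #ncSystems(S) ≤ 1`.
HONEST FRAMING: combinatorial lemmas towards the sign of the dense-end leading coefficient (Theorem D).  [this work]
-/

namespace Summit.CriticalPhenomena.PercolationContinuityZ3.Theorems

namespace SahiSparseEnd

open Finset Function SahiRepresentativeForm

variable {ι : Type*} [Fintype ι] [DecidableEq ι]

section Splits

variable {k : ℕ} {A : Fin k → Finset (Finset ι)} (hA : ∀ i a a', a ∈ A i → a ⊆ a' → a' ∈ A i) (hA0 : ∀ i, ∅ ∉ A i)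
  {hd : (doubly A).Nonempty} {c : Finset ι} (hc : c ∈ doubly A) (hcm : c.card = m2 A hd)

/-- The trace of event `i` on `2^c`. [this work] -/
def tr (A : Fin k → Finset (Finset ι)) (c : Finset ι) (i : Fin k) : Finset (Finset ι) := (A i).filter (· ⊆ c)

/-- The events containing `c`. [this work] -/
def Tc (A : Fin k → Finset (Finset ι)) (c : Finset ι) : Finset (Fin k) := univ.filter fun i => c ∈ A i

omit [Fintype ι] in
/-- Membership in a trace. [this work] -/
theorem mem_tr {i : Fin k} {a : Finset ι} : a ∈ tr A c i ↔ a ∈ A i ∧ a ⊆ c := by rw [tr, mem_filter]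

omit [Fintype ι] in
/-- Membership in `Tc`. [this work] -/
theorem mem_Tc {i : Fin k} : i ∈ Tc A c ↔ c ∈ A i := by simp [Tc]

include hcm in
/-- **Traces at a cheapest double failure meet pairwise only in `c`.** [this work] -/
theorem trace_pairwise {i j : Fin k} (hij : i ≠ j) {a : Finset ι} (hai : a ∈ tr A c i) (haj : a ∈ tr A c j) : a = c := by
  rw [mem_tr] at hai haj
  refine eq_of_subset_of_card_le hai.2 ?_
  rw [hcm]
  refine m2_le_card (mem_filter.2 ⟨mem_univ _, ?_⟩)
  have hsub : ({i, j} : Finset (Fin k)) ⊆ univ.filter fun l => a ∈ A l := by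
    intro l hl
    rw [mem_insert, mem_singleton] at hl
    rcases hl with rfl | rfl
    · exact mem_filter.2 ⟨mem_univ _, hai.1⟩
    · exact mem_filter.2 ⟨mem_univ _, haj.1⟩
  exact (card_pair hij).symm.le.trans (card_le_card hsub)

include hA hcm in
/-- **A split forces all other traces to be trivial**: if `a ∈ tr_i`, `b ∈ tr_j` (`i ≠ j`) are disjoint with `a ∪ b = c`, then every
member of any third trace `tr_l` (`l ≠ i, j`) is `c` itself. [this work] -/
theorem split_forces_top {i j l : Fin k} (hli : l ≠ i) (hlj : l ≠ j) {a b : Finset ι} (ha : a ∈ tr A c i)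
    (hb : b ∈ tr A c j) (hdis : Disjoint a b) (hun : a ∪ b = c) {x : Finset ι} (hx : x ∈ tr A c l) : x = c := by
  have hxc : x ⊆ c := (mem_tr.1 hx).2
  have hac : a ⊆ c := (mem_tr.1 ha).2
  have hbc : b ⊆ c := (mem_tr.1 hb).2
  have hup : ∀ {m : Fin k} {y z : Finset ι}, y ∈ tr A c m → y ⊆ z → z ⊆ c → z ∈ tr A c m := fun hy hyz hz =>
    mem_tr.2 ⟨hA _ _ _ (mem_tr.1 hy).1 hyz, hz⟩
  have h1 : x ∪ a = c := trace_pairwise hcm hli (hup hx subset_union_left (union_subset hxc hac))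
    (hup ha subset_union_right (union_subset hxc hac))
  have h2 : x ∪ b = c := trace_pairwise hcm hlj (hup hx subset_union_left (union_subset hxc hbc))
    (hup hb subset_union_right (union_subset hxc hbc))
  refine Subset.antisymm hxc fun y hy => ?_
  rcases mem_union.1 (hun.symm ▸ hy : y ∈ a ∪ b) with hya | hyb
  · -- `y ∈ a`, so `y ∉ b`; from `x ∪ b = c ∋ y` we get `y ∈ x`
    rcases mem_union.1 (h2.symm ▸ hy : y ∈ x ∪ b) with h | h
    · exact h
    · exact absurd h (disjoint_left.1 hdis hya)
  · rcases mem_union.1 (h1.symm ▸ hy : y ∈ x ∪ a) with h | h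
    · exact h
    · exact absurd hyb (disjoint_left.1 hdis h)

/-! ### The trace family of a sub-family `S ⊆ T(c)` -/

/-- The trace family of the sub-family indexed by `S`: `j ↦ tr_{S_j}` (increasing enumeration). [this work] -/
def traceFam (A : Fin k → Finset (Finset ι)) (S : Finset (Fin k)) (c : Finset ι) : Fin S.card → Finset (Finset ι) :=
  fun j => tr A c (S.orderEmbOfFin rfl j)

omit [Fintype ι] in
/-- `traceFam` is the general-arity trace of `subFam`. [this work] -/
theorem traceFam_eq (S : Finset (Fin k)) : traceFam A S c = fun j => (subFam A S j).filter (· ⊆ c) := rfl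

omit [Fintype ι] in
/-- Members of the traces lie inside `c`. [this work] -/
theorem traceFam_sub (S : Finset (Fin k)) : ∀ j a, a ∈ traceFam A S c j → a ⊆ c := fun _ _ h => (mem_tr.1 h).2

include hA in
omit [Fintype ι] in
/-- The traces are up-closed inside `2^c`. [this work] -/
theorem traceFam_up (S : Finset (Fin k)) : ∀ j a a', a ∈ traceFam A S c j → a ⊆ a' → a' ⊆ c → a' ∈ traceFam A S c j :=
  fun _ _ _ h haa' ha'c => mem_tr.2 ⟨hA _ _ _ (mem_tr.1 h).1 haa', ha'c⟩

include hA0 in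
omit [Fintype ι] in
/-- `∅` is in no trace. [this work] -/
theorem traceFam_empty_not_mem (S : Finset (Fin k)) : ∀ j, ∅ ∉ traceFam A S c j := fun _ h => hA0 _ (mem_tr.1 h).1

omit [Fintype ι] in
/-- `c` is in every trace of a sub-family of `T(c)`. [this work] -/
theorem traceFam_top_mem {S : Finset (Fin k)} (hS : S ⊆ Tc A c) : ∀ j, c ∈ traceFam A S c j :=
  fun j => mem_tr.2 ⟨mem_Tc.1 (hS (orderEmbOfFin_mem S rfl j)), subset_rfl⟩

include hcm in
/-- The traces of a sub-family meet pairwise only in `c`. [this work] -/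
theorem traceFam_pairwise (S : Finset (Fin k)) :
    ∀ j j', j ≠ j' → ∀ a, a ∈ traceFam A S c j → a ∈ traceFam A S c j' → a = c :=
  fun _ _ hjj' _ ha ha' => trace_pairwise hcm (fun h => hjj' ((S.orderEmbOfFin rfl).injective h)) ha ha'

/-! ### At most one splitting pair -/

include hA hcm in
/-- A non-constant admissible system of a PAIR `S = {i < j} ⊆ T(c)` is a split, and it trivialises every trace `tr_l`, `l ∉ S`.
[this work] -/
theorem top_of_ncSystems_pair {S : Finset (Fin k)} (hS2 : S.card = 2) {γ : Fin S.card → Finset ι}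
    (hγ : γ ∈ ncSystems (traceFam A S c) c) {l : Fin k} (hl : l ∉ S) {x : Finset ι} (hx : x ∈ tr A c l) : x = c := by
  rw [ncSystems, mem_erase] at hγ
  obtain ⟨hF, hdis, hun⟩ := mem_systems.1 hγ.2
  set e := S.orderEmbOfFin rfl with he
  have hne01 : γ ⟨0, by omega⟩ ≠ γ ⟨1, by omega⟩ := fun h =>
    hγ.1 (eq_const_of_apply_eq (traceFam_pairwise hcm S) hS2 hγ.2 h)
  have hd : Disjoint (γ ⟨0, by omega⟩) (γ ⟨1, by omega⟩) := (hdis _ _).resolve_left hne01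
  have hu : γ ⟨0, by omega⟩ ∪ γ ⟨1, by omega⟩ = c := by
    rw [← hun]
    ext y
    simp only [mem_union, mem_biUnion, mem_univ, true_and]
    constructor
    · rintro (h | h)
      · exact ⟨_, h⟩
      · exact ⟨_, h⟩
    · rintro ⟨m, hm⟩
      have : m = ⟨0, by omega⟩ ∨ m = ⟨1, by omega⟩ := by
        rcases m with ⟨m, hm'⟩
        have : m = 0 ∨ m = 1 := by omega
        rcases this with rfl | rfl
        · exact Or.inl rfl
        · exact Or.inr rfl
      rcases this with rfl | rfl
      · exact Or.inl hm
      · exact Or.inr hm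
  have hi : e ⟨0, by omega⟩ ∈ S := orderEmbOfFin_mem S rfl _
  have hj : e ⟨1, by omega⟩ ∈ S := orderEmbOfFin_mem S rfl _
  exact split_forces_top hA hcm (i := e ⟨0, by omega⟩) (j := e ⟨1, by omega⟩)
    (fun h => hl (by rw [h]; exact hi)) (fun h => hl (by rw [h]; exact hj)) (hF _) (hF _) hd hu hx

include hA hA0 hcm in
/-- **At most one pair splits**: if two pairs `S, S' ⊆ T(c)` both have a non-constant admissible system then `S = S'`. [this work] -/
theorem pair_eq_of_ncSystems_nonempty {S S' : Finset (Fin k)} (hS2 : S.card = 2) (hS'2 : S'.card = 2)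
    (hS : (ncSystems (traceFam A S c) c).Nonempty) (hS' : (ncSystems (traceFam A S' c) c).Nonempty) : S = S' := by
  by_contra hne
  obtain ⟨γ, hγ⟩ := hS
  obtain ⟨γ', hγ'⟩ := hS'
  -- an index of `S'` outside `S`
  have hnot : ¬ S' ⊆ S := fun h => hne (eq_of_subset_of_card_le h (by rw [hS2, hS'2])).symm
  obtain ⟨l, hlS', hlS⟩ := not_subset.1 hnot
  -- `l` is one of the two enumerated elements of `S'`
  obtain ⟨m, hm⟩ : ∃ m : Fin S'.card, S'.orderEmbOfFin rfl m = l := by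
    have : l ∈ Set.range (S'.orderEmbOfFin rfl) := by rw [range_orderEmbOfFin]; exact hlS'
    exact this
  -- the representative of `γ'` at `m` lies in `tr_l`, hence equals `c` (the split of `S` trivialises `tr_l`)
  have hγ'' := hγ'
  rw [ncSystems, mem_erase] at hγ''
  obtain ⟨hF', hdis', -⟩ := mem_systems.1 hγ''.2
  have hxl : γ' m ∈ tr A c l := hm ▸ hF' m
  have hxc : γ' m = c := top_of_ncSystems_pair hA hcm hS2 hγ hlS hxl
  -- but in a non-constant pair system no representative equals `c`
  have hne01 : γ' ⟨0, by omega⟩ ≠ γ' ⟨1, by omega⟩ := fun h =>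
    hγ''.1 (eq_const_of_apply_eq (traceFam_pairwise hcm S') hS'2 hγ''.2 h)
  have hd : Disjoint (γ' ⟨0, by omega⟩) (γ' ⟨1, by omega⟩) := (hdis' _ _).resolve_left hne01
  have hnz : ∀ m', γ' m' ≠ ∅ := fun m' h => traceFam_empty_not_mem hA0 S' m' (h ▸ hF' m')
  have hsubc : ∀ m', γ' m' ⊆ c := fun m' => traceFam_sub S' m' _ (hF' m')
  have hm01 : m = ⟨0, by omega⟩ ∨ m = ⟨1, by omega⟩ := by
    rcases m with ⟨mv, hmv⟩
    have : mv = 0 ∨ mv = 1 := by omega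
    rcases this with rfl | rfl
    · exact Or.inl rfl
    · exact Or.inr rfl
  rcases hm01 with h0 | h1
  · -- `γ' 0 = c`: then `γ' 1 ⊆ c` is disjoint from `c`, hence empty
    rw [h0] at hxc
    refine hnz ⟨1, by omega⟩ (eq_empty_of_forall_notMem fun y hy => ?_)
    exact disjoint_left.1 hd (hxc.symm ▸ hsubc _ hy) hy
  · rw [h1] at hxc
    refine hnz ⟨0, by omega⟩ (eq_empty_of_forall_notMem fun y hy => ?_)
    exact disjoint_left.1 hd hy (hxc.symm ▸ hsubc _ hy)

include hA hA0 hcm in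
/-- **`N(c) ≤ 1`**: the total number of splits over all pairs `S ⊆ T(c)` is at most one. [this work] -/
theorem sum_card_ncSystems_le_one :
    ∑ S ∈ (Tc A c).powersetCard 2, (ncSystems (traceFam A S c) c).card ≤ 1 := by
  by_cases h : ∃ S ∈ (Tc A c).powersetCard 2, (ncSystems (traceFam A S c) c).Nonempty
  · obtain ⟨S₀, hS₀, hne⟩ := h
    have hS₀2 : S₀.card = 2 := (mem_powersetCard.1 hS₀).2
    rw [sum_eq_single_of_mem S₀ hS₀ fun S hS hSS₀ => ?_]
    · exact card_ncSystems_le_one (traceFam_sub S₀) (traceFam_up hA S₀) (traceFam_pairwise hcm S₀) hS₀2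
    · rw [card_eq_zero, ← not_nonempty_iff_eq_empty]
      exact fun hS' => hSS₀ (pair_eq_of_ncSystems_nonempty hA hA0 hcm (mem_powersetCard.1 hS).2 hS₀2 hS' hne)
  · rw [sum_eq_zero fun S hS => ?_]
    · exact Nat.zero_le _
    · rw [card_eq_zero, ← not_nonempty_iff_eq_empty]
      exact fun hS' => h ⟨S, hS, hS'⟩

end Splits

end SahiSparseEnd

end Summit.CriticalPhenomena.PercolationContinuityZ3.Theorems
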